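import Summits.QuantumFields.GaugeBoot.DiagonalRPTorusPlaquetteSign
import Summits.QuantumFields.GaugeBoot.DiagonalRPGeometry
import Literature.MathematicalPhysics.QuantumLattice.LatticeGaugeDLRSymmetry
import HarnessLib

/-!
# Reflection positivity makes every character of a mirror-cut loop non-negative in mean:
torus diagonal RP, `ℤ^d` diagonal-RP states, Class-B states (gauge-boot, task L3(θ′), 3/3)

HONEST FRAMING (cell `pub-gaugeboot`, page 1 of every file): the venture produces certified bounds
on lattice expectations at stated coupling, gauge group, dimension and torus size; NOT a mass gap,
NOT a continuum limit, NOT a string tension; NOT Yang–Mills-summit-bearing (barriers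
`FixedCouplingUltralocality`, `PerturbativeInvisibility`). This module is a small structural
result about the states a loop-equation certificate with diagonal (`R_diag`) blocks speaks about
(Class B, SCOPING A18); it discharges nothing else.

## Content

`DiagonalRPTorusPlaquetteSign.lean` (1/3) showed: closed-half diagonal RP of the TORUS Wilson state
forces `⟨Re tr ρ(U_p)⟩ ≥ 0` for the representation `ρ` of the action. The mechanism is abstract
and is recorded here once, then specialised three times:

* **`integral_re_trace_mul_inv_nonneg_of_rp`** (the mechanism) — `G` compact, `τ : G → M_M(ℂ)`
  continuous, `σ = unitarize τ`; a finite measure `μ` on ANY configuration space `ι → G`, a map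
  `Θ` of configurations and two `G`-valued entrywise-measurable functions `C`, `D` with
  `C ∘ Θ = D`. If the `M²` reflection pairings `∫ (σ(C(ΘU))_{ab})‾ σ(C U)_{ab} dμ` are `≥ 0`
  (which is what ANY reflection positivity of `μ` w.r.t. `Θ` gives as soon as `C` is a half
  observable), then `0 ≤ ∫ Re tr τ(C U · (D U)⁻¹) dμ`: the loop `C D⁻¹` closed by the mirror image
  of the half path `C` has NON-NEGATIVE MEAN CHARACTER IN EVERY REPRESENTATION `τ`
  (`Re tr τ(g h⁻¹) = ∑_{ab} Re(σ(g)_{ab} conj σ(h)_{ab})`, tree `CompactGroup.re_trace_mul_inv_eq_sum`).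
* **`wilsonExpectation_re_trace_rep_plaquette_nonneg_of_diagonalReflectionPositive`** — torus
  `(ℤ/L)^d`, `L ≥ 2`: `DiagonalReflectionPositive ρ β i j → 0 ≤ ⟨Re tr τ(U_{0;ij})⟩_{Λ,β}` for
  EVERY continuous representation `τ` (1/3 had `τ = ρ`): the law of the cut plaquette is a class
  function of positive type.
* **`integral_re_trace_plaquette_nonneg_of_isReflectionPositiveFor_diag`** — `ℤ^d`: every finite
  measure `μ` on `LGConfig d G` which is reflection positive for the diagonal swap
  `configDiagSwapZd i j` and the closed half `diagHalfEdges i j` (`IsReflectionPositiveFor`, the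
  `R_diag` axiom of `ClassB.lean`) has `0 ≤ ∫ Re tr τ(U_{0;ij}) dμ` for every continuous `τ`.
* **`ClassBState.integral_re_trace_plaquette_nonneg`** / **`ClassBState.integral_plaquetteObs_nonneg`**
  — hence EVERY Class-B state `ω : ClassBState d ρ β` (translation invariant, diagonal RP for all
  pairs `i ≠ j`; NO use of the Gibbs property, of `β`, or of site/link RP) has
  `0 ≤ ∫ Re tr τ(U_{x;ij}) dω.μ` for every plaquette and every `τ`, in particular
  `0 ≤ ∫ plaquetteObs ρ x i j dω.μ`: the mean plaquette `u_P` of a Class-B state is `≥ 0` at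
  every `β`, whatever the sign of `β` — a loop-equation SDP with an `R_diag` block can never
  describe a negative-plaquette state (consistent with 1/3: no torus and no symmetric finite volume
  is diagonally RP at `β < 0`).

## What is NOT claimed

Nothing about which `β` admit Class-B states (inhabitation is open outside the uniqueness
windows, `ClassBStrongCoupling`); nothing about gauge-invariant-sector RP; no strict inequality.
The positivity of symmetric-loop characters under a reflection positivity is the standard first
consequence of RP (Osterwalder–Seiler 1978 §2; Seiler LNP 159 Ch. 2, for the site/link
reflections); the diagonal/torus/Class-B statements here are, as far as the cell's searches go, not
in print.
-/

open MeasureTheory Complex Finset Function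
open scoped ComplexOrder

namespace Summit.QuantumFields.GaugeBoot

open Literature.MathematicalPhysics.QuantumFieldTheory
open Literature.MathematicalPhysics.QuantumLattice
open Literature.RepresentationTheory.CompactGroups

noncomputable section

/-! ## The mechanism -/

section Mechanism

variable {ι : Type*} {M : ℕ} {G : Type*} [Group G] [TopologicalSpace G] [IsTopologicalGroup G]
  [CompactSpace G] [MeasurableSpace G] [BorelSpace G] (τ : G →* Matrix (Fin M) (Fin M) ℂ)

omit [BorelSpace G] in
/-- ★★ **RP pairings of the entries of a half path control the character of the closed loop.**
`τ` continuous, `σ = unitarize τ`; `μ` a finite measure on `ι → G`; `C, D : (ι → G) → G`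
entrywise measurable with `C ∘ Θ = D`. If `0 ≤ ∫ (σ(C(ΘU))_{ab})‾ σ(C U)_{ab} dμ` for all `a, b`
(in `ℂ`), then `0 ≤ ∫ Re tr τ(C U (D U)⁻¹) dμ`. -/
theorem integral_re_trace_mul_inv_nonneg_of_rp (hτ : Continuous τ) {μ : Measure (ι → G)}
    [IsFiniteMeasure μ] {Θ : (ι → G) → (ι → G)} {C D : (ι → G) → G}
    (hC : WilsonRP.EntryMeasurable (CompactGroup.unitarize τ hτ) C)
    (hD : WilsonRP.EntryMeasurable (CompactGroup.unitarize τ hτ) D) (hΘ : ∀ U, C (Θ U) = D U)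
    (hRP : ∀ a b, 0 ≤ ∫ U, (starRingEnd ℂ) (CompactGroup.unitarize τ hτ (C (Θ U)) a b) *
      CompactGroup.unitarize τ hτ (C U) a b ∂μ) :
    0 ≤ ∫ U, (τ (C U * (D U)⁻¹)).trace.re ∂μ := by
  set σ := CompactGroup.unitarize τ hτ with hσ
  -- the real integrands `g_{ab}` and their sum
  set g : Fin M → Fin M → (ι → G) → ℝ :=
    fun a b U => (σ (C U) a b * (starRingEnd ℂ) (σ (D U) a b)).re with hg
  have hsum : ∀ U : ι → G, (τ (C U * (D U)⁻¹)).trace.re = ∑ a, ∑ b, g a b U := fun U =>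
    CompactGroup.re_trace_mul_inv_eq_sum τ hτ (C U) (D U)
  have hfm : ∀ a b, Measurable fun U => σ (C U) a b * (starRingEnd ℂ) (σ (D U) a b) :=
    fun a b => (hC a b).mul (Complex.continuous_conj.measurable.comp (hD a b))
  have hfb : ∀ a b U, ‖σ (C U) a b * (starRingEnd ℂ) (σ (D U) a b)‖ ≤ 1 := fun a b U => by
    rw [norm_mul, Complex.norm_conj]
    calc ‖σ (C U) a b‖ * ‖σ (D U) a b‖ ≤ 1 * 1 :=
          mul_le_mul (CompactGroup.norm_unitarize_apply_le_one τ hτ _ a b)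
            (CompactGroup.norm_unitarize_apply_le_one τ hτ _ a b) (norm_nonneg _) zero_le_one
      _ = 1 := one_mul 1
  have hfi : ∀ a b, Integrable (fun U => σ (C U) a b * (starRingEnd ℂ) (σ (D U) a b)) μ :=
    fun a b => Integrable.of_bound (hfm a b).aestronglyMeasurable 1 (ae_of_all _ (hfb a b))
  have hgi : ∀ a b, Integrable (g a b) μ := fun a b => (hfi a b).re
  have hterm : ∀ a b, 0 ≤ ∫ U, g a b U ∂μ := by
    intro a b
    have h := hRP a b
    have hint : (fun U => (starRingEnd ℂ) (σ (C (Θ U)) a b) * σ (C U) a b) =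
        fun U => σ (C U) a b * (starRingEnd ℂ) (σ (D U) a b) := by
      funext U
      rw [hΘ U, mul_comm]
    rw [hint] at h
    have hre := integral_re (hfi a b)
    simp only [RCLike.re_to_complex] at hre
    change 0 ≤ ∫ U, (σ (C U) a b * (starRingEnd ℂ) (σ (D U) a b)).re ∂μ
    rw [hre]
    exact (Complex.nonneg_iff.1 h).1
  calc (0 : ℝ) ≤ ∑ a, ∑ b, ∫ U, g a b U ∂μ :=
        Finset.sum_nonneg fun a _ => Finset.sum_nonneg fun b _ => hterm a b
    _ = ∫ U, ∑ a, ∑ b, g a b U ∂μ := by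
        rw [integral_finsetSum Finset.univ
          (fun a _ => integrable_finsetSum Finset.univ fun b _ => hgi a b)]
        exact Finset.sum_congr rfl fun a _ =>
          (integral_finsetSum Finset.univ fun b _ => hgi a b).symm
    _ = ∫ U, (τ (C U * (D U)⁻¹)).trace.re ∂μ :=
        integral_congr_ae (ae_of_all _ fun U => (hsum U).symm)

end Mechanism

/-! ## Torus: every character of the cut plaquette -/

section Torus

variable {d L N M : ℕ} [NeZero L] {G : Type*} [Group G] [TopologicalSpace G] [IsTopologicalGroup G]
  [CompactSpace G] [MeasurableSpace G] [BorelSpace G] (ρ : G →* Matrix (Fin N) (Fin N) ℂ)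
  (τ : G →* Matrix (Fin M) (Fin M) ℂ)

/-- ★ **Torus closed-half diagonal RP ⇒ `0 ≤ ⟨Re tr τ(U_{0;ij})⟩_{Λ,β}` for EVERY continuous
representation `τ`** (`ρ` the representation of the Wilson action, `L ≥ 2`, `i ≠ j`): the law of
the mirror-cut plaquette under a diagonally RP torus state is of positive type. -/
theorem wilsonExpectation_re_trace_rep_plaquette_nonneg_of_diagonalReflectionPositive
    [Fact (1 < L)] (hρ : Continuous ρ) (hτ : Continuous τ) {β : ℝ} {i j : Fin d} (hij : i ≠ j)
    (hRP : DiagonalReflectionPositive (d := d) (L := L) ρ β i j) :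
    0 ≤ wilsonExpectation ρ β
      (fun U : GaugeConfig d L G => (τ (plaquetteHolonomy U 0 i j)).trace.re) := by
  haveI := isProbabilityMeasure_wilsonMeasure (d := d) (L := L) (G := G) ρ hρ β
  have hσc : Continuous (CompactGroup.unitarize τ hτ) := CompactGroup.continuous_unitarize τ hτ
  unfold wilsonExpectation
  simp_rw [plaquetteHolonomy_zero_eq_mul_inv]
  refine integral_re_trace_mul_inv_nonneg_of_rp τ hτ (Θ := configDiagSwap i j)
    (C := fun U : GaugeConfig d L G => U (0, i) * U ((0 : Site d L).shift i, j))
    (D := fun U : GaugeConfig d L G => U (0, j) * U ((0 : Site d L).shift j, i))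
    ((WilsonRP.entryMeasurable_apply hσc _).mul (WilsonRP.entryMeasurable_apply hσc _))
    ((WilsonRP.entryMeasurable_apply hσc _).mul (WilsonRP.entryMeasurable_apply hσc _))
    (fun U => halfPlaquette_configDiagSwap i j U) fun a b => ?_
  exact hRP (fun U => CompactGroup.unitarize τ hτ (U (0, i) * U ((0 : Site d L).shift i, j)) a b)
    (((WilsonRP.entryMeasurable_apply hσc _).mul (WilsonRP.entryMeasurable_apply hσc _)) a b)
    ⟨1, fun U => CompactGroup.norm_unitarize_apply_le_one τ hτ _ a b⟩
    (isDiagonalHalfObservable_comp_halfPlaquette hij fun x => CompactGroup.unitarize τ hτ x a b)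

end Torus

/-! ## `ℤ^d`: diagonal-RP states and Class-B states -/

section Zd

variable {d N M : ℕ} {G : Type*} [Group G] [TopologicalSpace G] [IsTopologicalGroup G]
  [CompactSpace G] [MeasurableSpace G] [BorelSpace G] (ρ : G →* Matrix (Fin N) (Fin N) ℂ)
  (τ : G →* Matrix (Fin M) (Fin M) ℂ)

omit [TopologicalSpace G] [IsTopologicalGroup G] [CompactSpace G] [MeasurableSpace G]
  [BorelSpace G] in
/-- The swap carries the transport `C = U(0,i) U(e_i,j)` to `D = U(0,j) U(e_j,i)` (`ℤ^d`). -/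
theorem halfPlaquetteZd_configDiagSwapZd (i j : Fin d) (U : LGConfig d G) :
    configDiagSwapZd i j U (0, i) * configDiagSwapZd i j U (Pi.single i 1, j) =
      U (0, j) * U (Pi.single j 1, i) := by
  have h0 : zdDiagSwap i j (0 : Fin d → ℤ) = 0 := DiagRP.zdDiagSwap_of_eq i j rfl
  have h1 : zdDiagSwap i j (Pi.single i (1 : ℤ)) = Pi.single j 1 := by
    have h := DiagRP.zdDiagSwap_add_single i j (0 : Fin d → ℤ) i 1
    rwa [zero_add, h0, zero_add, Equiv.swap_apply_left] at h
  simp only [configDiagSwapZd, h0, h1, Equiv.swap_apply_left, Equiv.swap_apply_right]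

omit [TopologicalSpace G] [IsTopologicalGroup G] [CompactSpace G] [MeasurableSpace G]
  [BorelSpace G] in
/-- The `ℤ^d` plaquette holonomy at the origin is `C D⁻¹`. -/
theorem plaquetteHolonomyZd_zero_eq_mul_inv (i j : Fin d) (U : LGConfig d G) :
    plaquetteHolonomyZd U 0 i j =
      (U (0, i) * U (Pi.single i 1, j)) * (U (0, j) * U (Pi.single j 1, i))⁻¹ := by
  simp only [plaquetteHolonomyZd, zero_add, mul_inv_rev, mul_assoc]

omit [TopologicalSpace G] [IsTopologicalGroup G] [CompactSpace G] [MeasurableSpace G]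
  [BorelSpace G] in
/-- Any function of `C = U(0,i) U(e_i,j)` depends only on the links of the closed half
`{x_i ≥ x_j}` (`diagHalfEdges i j`). -/
theorem dependsOn_comp_halfPlaquetteZd {α : Type*} {i j : Fin d} (hij : i ≠ j) (φ : G → α) :
    DependsOn (fun U : LGConfig d G => φ (U (0, i) * U (Pi.single i 1, j))) (diagHalfEdges i j) := by
  intro U V hUV
  have hji : j ≠ i := fun h => hij h.symm
  have hA : U (0, i) = V (0, i) := hUV (0, i) (by simp [diagHalfEdges, hij])
  have hB : U (Pi.single i 1, j) = V (Pi.single i 1, j) :=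
    hUV _ (by simp [diagHalfEdges, Pi.single_eq_of_ne hji])
  simp only [hA, hB]

/-- ★★ **A diagonally reflection-positive state on `ℤ^d` has every cut-plaquette character
non-negative in mean.** `μ` a finite measure on `LGConfig d G`, reflection positive for the swap
`configDiagSwapZd i j` on the closed half `diagHalfEdges i j` (`i ≠ j`); `τ` ANY continuous
representation of the compact group `G`: `0 ≤ ∫ Re tr τ(U_{0;ij}) dμ`. -/
theorem integral_re_trace_plaquette_nonneg_of_isReflectionPositiveFor_diag (hτ : Continuous τ)
    {μ : Measure (LGConfig d G)} [IsFiniteMeasure μ] {i j : Fin d} (hij : i ≠ j)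
    (hRP : IsReflectionPositiveFor (configDiagSwapZd i j) (diagHalfEdges i j) μ) :
    0 ≤ ∫ U, (τ (plaquetteHolonomyZd U 0 i j)).trace.re ∂μ := by
  have hσc : Continuous (CompactGroup.unitarize τ hτ) := CompactGroup.continuous_unitarize τ hτ
  simp_rw [plaquetteHolonomyZd_zero_eq_mul_inv]
  refine integral_re_trace_mul_inv_nonneg_of_rp τ hτ (Θ := configDiagSwapZd i j)
    (C := fun U : LGConfig d G => U (0, i) * U (Pi.single i 1, j))
    (D := fun U : LGConfig d G => U (0, j) * U (Pi.single j 1, i))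
    ((WilsonRP.entryMeasurable_apply hσc _).mul (WilsonRP.entryMeasurable_apply hσc _))
    ((WilsonRP.entryMeasurable_apply hσc _).mul (WilsonRP.entryMeasurable_apply hσc _))
    (fun U => halfPlaquetteZd_configDiagSwapZd i j U) fun a b => ?_
  exact hRP (fun U => CompactGroup.unitarize τ hτ (U (0, i) * U (Pi.single i 1, j)) a b)
    (((WilsonRP.entryMeasurable_apply hσc _).mul (WilsonRP.entryMeasurable_apply hσc _)) a b)
    ⟨1, fun U => CompactGroup.norm_unitarize_apply_le_one τ hτ _ a b⟩
    (dependsOn_comp_halfPlaquetteZd hij fun x => CompactGroup.unitarize τ hτ x a b)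

/-- ★★ **Every Class-B state has non-negative mean plaquette character, in every representation,
for every plaquette.** `ω : ClassBState d ρ β` (any `β`; only translation invariance and the
diagonal RP of `ω` are used), `τ` continuous, `x ∈ ℤ^d`, `i ≠ j`:
`0 ≤ ∫ Re tr τ(U_{x;ij}) dω.μ`. -/
theorem ClassBState.integral_re_trace_plaquette_nonneg {β : ℝ} (ω : ClassBState d ρ β)
    (hτ : Continuous τ) (x : Fin d → ℤ) {i j : Fin d} (hij : i ≠ j) :
    0 ≤ ∫ U, (τ (plaquetteHolonomyZd U x i j)).trace.re ∂ω.μ := by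
  haveI := ω.isProbabilityMeasure
  have h0 := integral_re_trace_plaquette_nonneg_of_isReflectionPositiveFor_diag τ hτ hij
    (ω.diagRP i j hij)
  -- move the plaquette to the origin by translation invariance
  have hT : ∫ U, (τ (plaquetteHolonomyZd U x i j)).trace.re ∂ω.μ =
      ∫ U, (τ (plaquetteHolonomyZd U 0 i j)).trace.re ∂ω.μ := by
    conv_lhs => rw [← ω.translationInvariant x]
    rw [integral_map_equiv]
    refine integral_congr_ae (ae_of_all _ fun U => ?_)
    have h := plaquetteHolonomyZd_configShift_add x U 0 i j
    rw [zero_add] at h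
    simp only [h]
  rw [hT]
  exact h0

/-- ★★ **In particular `u_P ≥ 0` for every Class-B state**: `0 ≤ ∫ plaquetteObs ρ x i j dω.μ`
(the mean plaquette in the representation of the action; `i ≠ j`; any `β`). A loop-equation
certificate with `R_diag` blocks speaks about states with a non-negative plaquette only. -/
theorem ClassBState.integral_plaquetteObs_nonneg {β : ℝ} (ω : ClassBState d ρ β)
    (hρ : Continuous ρ) (x : Fin d → ℤ) {i j : Fin d} (hij : i ≠ j) :
    0 ≤ ∫ U, plaquetteObs ρ x i j U ∂ω.μ :=
  ClassBState.integral_re_trace_plaquette_nonneg ρ ρ ω hρ x hij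

end Zd

end

end Summit.QuantumFields.GaugeBoot
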